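import Summits.Langlands.Langlands.Statement
import Summits.Langlands.Langlands.Theorems.IrreducibilityBySelfDualityIrreducibleOffSectorTransfer
import HarnessLib

/-!
# Irreducible geometric constituents of a geometric framed Galois representation
(support item stmt-Langlands-14329 `IrreducibilityBySelfDuality.IrreducibleOffSector`, route
`route-Langlands-IrreducibilityBySelfDuality`, line `Sketch`, stub `stub_constituentsAssembly`)

Given the two other stubs of the line as hypotheses —

* *frame dévissage*: a proper non-zero stable subspace of `kⁿ` under a continuous
  `ψ : G →ₜ* GL_n(k)` puts a conjugate `P ψ P⁻¹` in block upper triangular form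
  `reindex e e (fromBlocks (A g) (B g) 0 (D g))` with CONTINUOUS diagonal blocks
  `A : G →ₜ* GL_m(k)`, `D : G →ₜ* GL_p(k)`, `0 < m, p < n`;
* *de Rham blocks*: for such a block form of a local `ρ : Γ_F →ₜ* GL_n(ℚ̄_ℓ)`, de Rham-ness of
  `ρ` (relative to a `PstWeilDeligneData`) passes to `A` and `D` —

every GEOMETRIC `ρ : Γ_K →ₜ* GL_n(ℚ̄_ℓ)` (`Summit.Langlands.IsGeometricFramed`: unramified almost
everywhere, de Rham above `ℓ`) with `0 < n` has a finite family of IRREDUCIBLE GEOMETRIC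
constituents `r i : Γ_K →ₜ* GL_{m i}(ℚ̄_ℓ)`, `0 < m i`, `1 ≤ k`, with
`det(X - ρ(g)) = ∏ i det(X - r i (g))` for all `g`, and `k = 1` only if `ρ` is irreducible
(`stub_constituentsAssembly`).  Proof: strong induction on `n`; if `ρ` is reducible, dévissage along
a proper non-zero stable subspace, the diagonal blocks are unramified wherever `ρ` is
(`blocks_eq_one_of_eq_one`: `ρ σ = 1 ⇒ A σ = 1 ∧ D σ = 1`) and de Rham above `ℓ` (the block form
restricts to decomposition groups definitionally), and the constituents of `A` and `D` are
concatenated (`Fin.append`, `Fin.prod_univ_add`, `Matrix.charpoly_fromBlocks_zero₂₁`).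

References: N. Bourbaki, *Algèbre* VIII (2012), § 20 n° 6 (Jordan–Hölder constituents and
characteristic polynomials); J.-M. Fontaine, B. Mazur, *Geometric Galois representations* (1995), §1.
-/

noncomputable section

-- `Summit.Langlands.Langlands.…` (summit = sub-problem name, D-0017 layout) trips `dupNamespace` on
-- every declaration; the project-wide lakefile option is repeated here for stand-alone elaboration.
set_option linter.dupNamespace false

open scoped NumberField Classical
open Filter IsDedekindDomain
open Literature.NumberTheory.Automorphic Literature.NumberTheory.GaloisRepresentations
open Summit.Langlands

namespace Summit.Langlands.Langlands.Theorems.IrreducibleOffSector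

/-! ### Block upper triangular frames: kernel and characteristic polynomial -/

/-- If `P ψ(g) P⁻¹ = reindex e e (fromBlocks (A g) (B g) 0 (D g))` for all `g`, then
`ψ g = 1 ⇒ A g = 1 ∧ D g = 1` (compare the diagonal blocks of `1 = fromBlocks 1 0 0 1`). [folklore] -/
theorem blocks_eq_one_of_eq_one {k : Type*} [CommRing k] [TopologicalSpace k] [IsTopologicalRing k]
    {G : Type*} [Group G] [TopologicalSpace G] {n m p : ℕ} (e : Fin m ⊕ Fin p ≃ Fin n)
    (P : GL (Fin n) k) (ψ : G →ₜ* GL (Fin n) k) (A : G →ₜ* GL (Fin m) k) (D : G →ₜ* GL (Fin p) k)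
    (B : G → Matrix (Fin m) (Fin p) k)
    (hblock : ∀ g, ((FramedRep.conj P ψ g : GL (Fin n) k) : Matrix (Fin n) (Fin n) k) =
      Matrix.reindex e e (Matrix.fromBlocks ((A g : GL (Fin m) k) : Matrix (Fin m) (Fin m) k)
        (B g) 0 ((D g : GL (Fin p) k) : Matrix (Fin p) (Fin p) k)))
    {g : G} (hg : ψ g = 1) : A g = 1 ∧ D g = 1 := by
  have h1 : ((FramedRep.conj P ψ g : GL (Fin n) k) : Matrix (Fin n) (Fin n) k) = 1 := by
    rw [FramedRep.conj_apply, hg, mul_one, mul_inv_cancel, Units.val_one]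
  have h2 : Matrix.fromBlocks ((A g : GL (Fin m) k) : Matrix (Fin m) (Fin m) k) (B g) 0
      ((D g : GL (Fin p) k) : Matrix (Fin p) (Fin p) k) = Matrix.fromBlocks 1 0 0 1 := by
    refine (Matrix.reindex e e).injective ?_
    rw [← hblock g, h1, Matrix.fromBlocks_one, Matrix.reindex_apply, Matrix.submatrix_one_equiv]
  obtain ⟨hA, -, -, hD⟩ := Matrix.fromBlocks_inj.mp h2
  exact ⟨Units.val_eq_one.mp hA, Units.val_eq_one.mp hD⟩

/-- If `P ψ(g) P⁻¹ = reindex e e (fromBlocks (A g) (B g) 0 (D g))` for all `g`, then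
`det(X - ψ(g)) = det(X - A(g)) · det(X - D(g))` (`Matrix.charpoly_units_conj`,
`Matrix.charpoly_reindex`, `Matrix.charpoly_fromBlocks_zero₂₁`). [folklore] -/
theorem charpoly_eq_mul_of_blocks {k : Type*} [CommRing k] [TopologicalSpace k]
    [IsTopologicalRing k] {G : Type*} [Group G] [TopologicalSpace G] {n m p : ℕ}
    (e : Fin m ⊕ Fin p ≃ Fin n) (P : GL (Fin n) k) (ψ : G →ₜ* GL (Fin n) k)
    (A : G →ₜ* GL (Fin m) k) (D : G →ₜ* GL (Fin p) k) (B : G → Matrix (Fin m) (Fin p) k)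
    (hblock : ∀ g, ((FramedRep.conj P ψ g : GL (Fin n) k) : Matrix (Fin n) (Fin n) k) =
      Matrix.reindex e e (Matrix.fromBlocks ((A g : GL (Fin m) k) : Matrix (Fin m) (Fin m) k)
        (B g) 0 ((D g : GL (Fin p) k) : Matrix (Fin p) (Fin p) k)))
    (g : G) : FramedRep.charpoly ψ g = FramedRep.charpoly A g * FramedRep.charpoly D g := by
  have hconj : FramedRep.charpoly (FramedRep.conj P ψ) g = FramedRep.charpoly ψ g := by
    simp only [FramedRep.charpoly, FramedRep.conj_apply, Units.val_mul, Matrix.coe_units_inv]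
    exact Matrix.charpoly_units_conj P _
  rw [← hconj, FramedRep.charpoly, hblock g, Matrix.charpoly_reindex,
    Matrix.charpoly_fromBlocks_zero₂₁]
  rfl

/-! ### Reducibility gives a proper non-zero stable subspace -/

/-- If `0 < n` and `ρ : Γ_K →ₜ* GL_n(A)` is NOT irreducible, its representation on `Aⁿ` has a
proper non-zero subrepresentation (the lattice of subrepresentations is non-trivial, `⊥ ≠ ⊤`, so
`¬ IsSimpleOrder` produces such a `W`). [folklore] -/
theorem exists_ne_bot_ne_top_of_not_isIrreducible {K : Type} [Field K] {A : Type} [Field A]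
    [TopologicalSpace A] [IsTopologicalRing A] {n : ℕ} (ρ : FramedGaloisRep K A n) (hn : 0 < n)
    (h : ¬ ρ.toGaloisRep.IsIrreducible) :
    ∃ W : Subrepresentation (FramedRep.toRepresentation ρ), W ≠ ⊥ ∧ W ≠ ⊤ := by
  by_contra hno
  apply h
  change IsSimpleOrder (Subrepresentation (FramedRep.toRepresentation ρ))
  haveI : Nonempty (Fin n) := Fin.pos_iff_nonempty.mp hn
  have hbot : (⊥ : Subrepresentation (FramedRep.toRepresentation ρ)).toSubmodule = ⊥ := rfl
  have htop : (⊤ : Subrepresentation (FramedRep.toRepresentation ρ)).toSubmodule = ⊤ := rfl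
  haveI : Nontrivial (Subrepresentation (FramedRep.toRepresentation ρ)) := by
    refine ⟨⟨⊥, ⊤, fun h' => ?_⟩⟩
    have h'' := congrArg Subrepresentation.toSubmodule h'
    rw [hbot, htop] at h''
    exact bot_ne_top h''
  exact ⟨fun W => or_iff_not_imp_left.mpr fun hW =>
    Classical.byContradiction fun hW' => hno ⟨W, hW, hW'⟩⟩

/-! ### The constituents, as a family of dependent pairs -/

/-- **Irreducible geometric constituents** (sigma-type form, by strong induction on the rank):
under the frame-dévissage and de Rham-blocks hypotheses, every geometric
`ρ : Γ_K →ₜ* GL_n(ℚ̄_ℓ)` with `0 < n` has a family `f : Fin k → Σ d, (Γ_K →ₜ* GL_d(ℚ̄_ℓ))`,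
`1 ≤ k`, of irreducible geometric representations of positive ranks with
`det(X - ρ(g)) = ∏ i det(X - (f i).2 (g))`, and `k = 1` only if `ρ` is irreducible.
Bourbaki A VIII § 20 n° 6. [folklore] -/
theorem exists_irreducible_geometric_constituents_sigma
    (hdev : ∀ {k : Type} [Field k] [TopologicalSpace k] [IsTopologicalRing k]
      {G : Type} [Group G] [TopologicalSpace G] {n : ℕ} (ψ : G →ₜ* GL (Fin n) k)
      (W : Subrepresentation (FramedRep.toRepresentation ψ)), W ≠ ⊥ → W ≠ ⊤ →
      ∃ (m p : ℕ) (_ : m < n) (_ : p < n) (_ : 0 < m) (_ : 0 < p) (e : Fin m ⊕ Fin p ≃ Fin n)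
        (P : GL (Fin n) k) (A : G →ₜ* GL (Fin m) k) (D : G →ₜ* GL (Fin p) k)
        (B : G → Matrix (Fin m) (Fin p) k),
        ∀ g, ((FramedRep.conj P ψ g : GL (Fin n) k) : Matrix (Fin n) (Fin n) k) =
          Matrix.reindex e e (Matrix.fromBlocks ((A g : GL (Fin m) k) : Matrix (Fin m) (Fin m) k)
            (B g) 0 ((D g : GL (Fin p) k) : Matrix (Fin p) (Fin p) k)))
    (hdR : ∀ {F : Type} [Field F] [ValuativeRel F] [TopologicalSpace F]
      [IsNonarchimedeanLocalField F]
      {ℓ : ℕ} [Fact ℓ.Prime] (𝔇 : PstWeilDeligneData F ℓ) {n m p : ℕ} (e : Fin m ⊕ Fin p ≃ Fin n)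
      (P : GL (Fin n) (PadicAlgCl ℓ)) (ρ : FramedRep (Field.absoluteGaloisGroup F) (PadicAlgCl ℓ) n)
      (A : FramedRep (Field.absoluteGaloisGroup F) (PadicAlgCl ℓ) m)
      (D : FramedRep (Field.absoluteGaloisGroup F) (PadicAlgCl ℓ) p)
      (B : Field.absoluteGaloisGroup F → Matrix (Fin m) (Fin p) (PadicAlgCl ℓ)),
      (∀ g, ((FramedRep.conj P ρ g : GL (Fin n) (PadicAlgCl ℓ)) :
          Matrix (Fin n) (Fin n) (PadicAlgCl ℓ)) =
        Matrix.reindex e e (Matrix.fromBlocks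
          ((A g : GL (Fin m) (PadicAlgCl ℓ)) : Matrix (Fin m) (Fin m) (PadicAlgCl ℓ)) (B g) 0
          ((D g : GL (Fin p) (PadicAlgCl ℓ)) : Matrix (Fin p) (Fin p) (PadicAlgCl ℓ)))) →
      𝔇.IsDeRhamFramed ρ → 𝔇.IsDeRhamFramed A ∧ 𝔇.IsDeRhamFramed D)
    (K : Type) [Field K] [NumberField K] (ℓ : ℕ) [Fact ℓ.Prime] (Rec : ReciprocityData K) (n : ℕ) :
    ∀ ρ : FramedGaloisRep K (PadicAlgCl ℓ) n, 0 < n → IsGeometricFramed Rec ρ →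
      ∃ (k : ℕ) (f : Fin k → Σ d, FramedGaloisRep K (PadicAlgCl ℓ) d),
        1 ≤ k ∧
        (∀ i, 0 < (f i).1 ∧ (f i).2.toGaloisRep.IsIrreducible ∧ IsGeometricFramed Rec (f i).2) ∧
        (∀ g, FramedRep.charpoly ρ g = ∏ i, FramedRep.charpoly (f i).2 g) ∧
        (k = 1 → ρ.toGaloisRep.IsIrreducible) := by
  induction n using Nat.strong_induction_on with
  | _ n ih =>
    intro ρ hn hgeo
    by_cases hirr : ρ.toGaloisRep.IsIrreducible
    · -- `ρ` is its own unique constituent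
      refine ⟨1, fun _ => ⟨n, ρ⟩, le_rfl, fun _ => ⟨hn, hirr, hgeo⟩, fun g => ?_, fun _ => hirr⟩
      rw [Fin.prod_univ_one]
    -- dévissage along a proper non-zero stable subspace
    obtain ⟨W, hW0, hW1⟩ := exists_ne_bot_ne_top_of_not_isIrreducible ρ hn hirr
    obtain ⟨m, p, hmn, hpn, hm, hp, e, P, A, D, B, hblock⟩ := hdev ρ W hW0 hW1
    -- the diagonal blocks are geometric: unramified wherever `ρ` is, de Rham above `ℓ`
    have hker : ∀ σ, ρ σ = 1 → A σ = 1 ∧ D σ = 1 := fun σ hσ =>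
      blocks_eq_one_of_eq_one e P ρ A D B hblock hσ
    have hloc : ∀ (v : HeightOneSpectrum (𝓞 K)) (hv : ((ℓ : ℕ) : 𝓞 K) ∈ v.asIdeal),
        (Rec.pst ℓ v hv).IsDeRhamFramed (FramedGaloisRep.toLocal v A) ∧
          (Rec.pst ℓ v hv).IsDeRhamFramed (FramedGaloisRep.toLocal v D) := fun v hv =>
      hdR (Rec.pst ℓ v hv) e P (ρ.toLocal v) (FramedGaloisRep.toLocal v A)
        (FramedGaloisRep.toLocal v D) (B ∘ absGaloisRestrict K (v.adicCompletion K))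
        (fun σ => hblock _) (hgeo.2 v hv)
    have hgeoA : IsGeometricFramed Rec A :=
      ⟨hgeo.1.mono fun v hv 𝔓 h𝔓 σ hσ => (hker σ (hv 𝔓 h𝔓 σ hσ)).1, fun v hv => (hloc v hv).1⟩
    have hgeoD : IsGeometricFramed Rec D :=
      ⟨hgeo.1.mono fun v hv 𝔓 h𝔓 σ hσ => (hker σ (hv 𝔓 h𝔓 σ hσ)).2, fun v hv => (hloc v hv).2⟩
    -- constituents of the blocks, concatenated
    obtain ⟨k₁, f₁, hk₁, hf₁, hcp₁, -⟩ := ih m hmn A hm hgeoA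
    obtain ⟨k₂, f₂, hk₂, hf₂, hcp₂, -⟩ := ih p hpn D hp hgeoD
    refine ⟨k₁ + k₂, Fin.append f₁ f₂, by omega, fun i => ?_, fun g => ?_, fun h => by omega⟩
    · refine Fin.addCases (fun i => ?_) (fun i => ?_) i
      · rw [Fin.append_left]
        exact hf₁ i
      · rw [Fin.append_right]
        exact hf₂ i
    · rw [charpoly_eq_mul_of_blocks e P ρ A D B hblock g, hcp₁ g, hcp₂ g, Fin.prod_univ_add]
      congr 1
      · exact Finset.prod_congr rfl fun i _ => by rw [Fin.append_left]
      · exact Finset.prod_congr rfl fun i _ => by rw [Fin.append_right]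

/-! ### The registered stub -/

/-- **Stub `stub_constituentsAssembly`** of the line `Sketch` for the crux `IrreducibleOffSector`:
granted frame dévissage (first hypothesis) and de Rham-ness of the diagonal blocks (second
hypothesis), every geometric `ρ : Γ_K →ₜ* GL_n(ℚ̄_ℓ)` with `0 < n` has irreducible geometric
constituents `r i : Γ_K →ₜ* GL_{m i}(ℚ̄_ℓ)` (`1 ≤ k`, `0 < m i`) with
`det(X - ρ(g)) = ∏ i det(X - r i (g))`, and `k = 1 → ρ` irreducible.  Immediate from
`exists_irreducible_geometric_constituents_sigma` (split the dependent pairs).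
Bourbaki A VIII § 20 n° 6; Fontaine–Mazur 1995 §1. [folklore] -/
theorem stub_constituentsAssembly :
    (∀ {k : Type} [Field k] [TopologicalSpace k] [IsTopologicalRing k]
      {G : Type} [Group G] [TopologicalSpace G] {n : ℕ} (ψ : G →ₜ* GL (Fin n) k)
      (W : Subrepresentation (FramedRep.toRepresentation ψ)), W ≠ ⊥ → W ≠ ⊤ →
      ∃ (m p : ℕ) (_ : m < n) (_ : p < n) (_ : 0 < m) (_ : 0 < p) (e : Fin m ⊕ Fin p ≃ Fin n)
        (P : GL (Fin n) k) (A : G →ₜ* GL (Fin m) k) (D : G →ₜ* GL (Fin p) k)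
        (B : G → Matrix (Fin m) (Fin p) k),
        ∀ g, ((FramedRep.conj P ψ g : GL (Fin n) k) : Matrix (Fin n) (Fin n) k) =
          Matrix.reindex e e (Matrix.fromBlocks ((A g : GL (Fin m) k) : Matrix (Fin m) (Fin m) k)
            (B g) 0 ((D g : GL (Fin p) k) : Matrix (Fin p) (Fin p) k))) →
    (∀ {F : Type} [Field F] [ValuativeRel F] [TopologicalSpace F] [IsNonarchimedeanLocalField F]
      {ℓ : ℕ} [Fact ℓ.Prime] (𝔇 : PstWeilDeligneData F ℓ) {n m p : ℕ} (e : Fin m ⊕ Fin p ≃ Fin n)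
      (P : GL (Fin n) (PadicAlgCl ℓ)) (ρ : FramedRep (Field.absoluteGaloisGroup F) (PadicAlgCl ℓ) n)
      (A : FramedRep (Field.absoluteGaloisGroup F) (PadicAlgCl ℓ) m)
      (D : FramedRep (Field.absoluteGaloisGroup F) (PadicAlgCl ℓ) p)
      (B : Field.absoluteGaloisGroup F → Matrix (Fin m) (Fin p) (PadicAlgCl ℓ)),
      (∀ g, ((FramedRep.conj P ρ g : GL (Fin n) (PadicAlgCl ℓ)) : Matrix (Fin n) (Fin n) (PadicAlgCl ℓ)) =
        Matrix.reindex e e (Matrix.fromBlocks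
          ((A g : GL (Fin m) (PadicAlgCl ℓ)) : Matrix (Fin m) (Fin m) (PadicAlgCl ℓ)) (B g) 0
          ((D g : GL (Fin p) (PadicAlgCl ℓ)) : Matrix (Fin p) (Fin p) (PadicAlgCl ℓ)))) →
      𝔇.IsDeRhamFramed ρ → 𝔇.IsDeRhamFramed A ∧ 𝔇.IsDeRhamFramed D) →
    ∀ (K : Type) [Field K] [NumberField K] (ℓ : ℕ) [Fact ℓ.Prime] (n : ℕ) (Rec : ReciprocityData K)
      (ρ : FramedGaloisRep K (PadicAlgCl ℓ) n), 0 < n → IsGeometricFramed Rec ρ →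
      ∃ (k : ℕ) (m : Fin k → ℕ) (r : ∀ i, FramedGaloisRep K (PadicAlgCl ℓ) (m i)),
        1 ≤ k ∧
        (∀ i, 0 < m i ∧ (r i).toGaloisRep.IsIrreducible ∧ IsGeometricFramed Rec (r i)) ∧
        (∀ g, FramedRep.charpoly ρ g = ∏ i, FramedRep.charpoly (r i) g) ∧
        (k = 1 → ρ.toGaloisRep.IsIrreducible) := by
  intro hdev hdR K _ _ ℓ _ n Rec ρ hn hgeo
  obtain ⟨k, f, hk, hf, hcp, hone⟩ :=
    exists_irreducible_geometric_constituents_sigma hdev hdR K ℓ Rec n ρ hn hgeo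
  exact ⟨k, fun i => (f i).1, fun i => (f i).2, hk, hf, hcp, hone⟩

end Summit.Langlands.Langlands.Theorems.IrreducibleOffSector

end
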